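import Summits.Parity.GeneralizedHardyLittlewood.Theorems.ParityLeakOneFifthParityLeakSieveErrCells
import HarnessLib

/-!
# Route ParityLeakOneFifth, crux `ParityLeakSieve` (stmt-Parity-18381), skeleton `birth`:
# the error cells of the host side of stub S1, II

Continuation of `…ParityLeakSieveErrCells.lean`: the cell `Ω = 5` of the `x^{1/5}`-rough integers on
the host side is `o(x/log²x)` (`P5_count_le`: sieve step at `x^{1/10}`, Alladi's asymptotic and the
continuity of `I₅` at `5`, where it vanishes), and the assembled bound `host_err_le`: the three error
sums of the pointwise lower-bound sieve, weighted by `log n ≤ 2 log x`, are `≤ δ x/log x`.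
-/

namespace Summit.Parity.GeneralizedHardyLittlewood.Theorems.ParityLeakOneFifth

open Finset Real
open scoped ArithmeticFunction.Omega
open Literature.NumberTheory.Sieve

set_option maxHeartbeats 800000 in
/-- **The `Ω = 5` cell on the host side is `o(x/log²x)`.** For every `η > 0` and `x ≥ x₀(η)`: the
`x^{1/10}`-rough `m ∈ (x, 2x]` with `⌈x^{1/5}⌉ ≤ P⁻(m+2)` and `Ω(m+2) = 5` number at most `η x/log²x`
(sieve step at `x^{1/10}` + Alladi's asymptotic with `I₅(u) → 0` as `u → 5⁺`). -/
theorem P5_count_le : ∀ η : ℝ, 0 < η → ∃ x₀ : ℕ, ∀ x : ℕ, x₀ ≤ x →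
    (#((Finset.Ioc x (2 * x)).filter (fun m : ℕ =>
        (∀ p ∈ m.primeFactors, (x : ℝ) ^ ((1 : ℝ) / 10) ≤ (p : ℝ)) ∧
        ⌈(x : ℝ) ^ ((1 : ℝ) / 5)⌉₊ ≤ (m + 2).minFac ∧ ArithmeticFunction.cardFactors (m + 2) = 4 + 1)) : ℝ) ≤
      η * (x : ℝ) / Real.log (x : ℝ) ^ 2 := by
  intro η hη
  obtain ⟨C₁, C₂, hC₁, hC₂, hTC⟩ := twistedCell_sieve_le 4 6 3
  obtain ⟨CA, hCA, hAl⟩ := exists_abs_roughCell_sub_main_le 4 6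
  -- continuity of `I₅` at `5`, where it vanishes
  set e : ℝ := η / (160 * (1 + C₁)) with he
  have he0 : 0 < e := by positivity
  have hcont : ContinuousAt (roughCellDensity 5) 5 :=
    (continuous_roughCellDensity (by norm_num)).continuousAt
  obtain ⟨τ, hτ, hτe⟩ := Metric.continuousAt_iff.1 hcont e he0
  have hρ5 : roughCellDensity 5 5 = 0 := roughCellDensity_of_le (by norm_num) (by norm_num)
  -- `x` large
  set M : ℝ := max 200 (max (20 / τ) (2 * (2000 * CA * (1 + C₁) + 8 * C₂) / η)) with hM
  refine ⟨⌈Real.exp M⌉₊, fun x hx => ?_⟩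
  have hxE : Real.exp M ≤ (x : ℝ) := (Nat.le_ceil _).trans (by exact_mod_cast hx)
  have hx0 : (0 : ℝ) < x := (Real.exp_pos _).trans_le hxE
  set ℓ : ℝ := Real.log (x : ℝ) with hℓ
  have hℓM : M ≤ ℓ := by rw [hℓ, Real.le_log_iff_exp_le hx0]; exact hxE
  have hℓ200 : 200 ≤ ℓ := (le_max_left _ _).trans hℓM
  have hℓτ : 20 / τ ≤ ℓ := ((le_max_left _ _).trans (le_max_right _ _)).trans hℓM
  have hℓη : 2 * (2000 * CA * (1 + C₁) + 8 * C₂) / η ≤ ℓ :=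
    ((le_max_right _ _).trans (le_max_right _ _)).trans hℓM
  have hℓ0 : 0 < ℓ := by linarith
  have hx1 : (1 : ℝ) < x := by
    have : Real.exp 0 < Real.exp M := Real.exp_lt_exp.2 (by linarith [le_max_left (200:ℝ) (max (20 / τ) (2 * (2000 * CA * (1 + C₁) + 8 * C₂) / η))])
    rw [Real.exp_zero] at this; linarith
  have hlog4 : Real.log 4 ≤ 2 := by
    have := Real.log_two_lt_d9
    rw [show (4 : ℝ) = 2 ^ 2 by norm_num, Real.log_pow]; push_cast; linarith
  -- parameters
  set w : ℝ := (x : ℝ) ^ ((1 : ℝ) / 10) with hw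
  set y : ℝ := (x : ℝ) ^ ((1 : ℝ) / 5) with hy
  have hw0 : 0 < w := Real.rpow_pos_of_pos hx0 _
  have hy0 : 0 < y := Real.rpow_pos_of_pos hx0 _
  have hlogw : Real.log w = ℓ / 10 := by rw [hw, Real.log_rpow hx0]; ring
  have hwexp : w = Real.exp (ℓ / 10) := by rw [← hlogw, Real.exp_log hw0]
  have hlogy : Real.log y = ℓ / 5 := by rw [hy, Real.log_rpow hx0]; ring
  have hyexp : y = Real.exp (ℓ / 5) := by rw [← hlogy, Real.exp_log hy0]
  have hw2 : 2 < w := by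
    rw [hwexp]
    have h1 : Real.exp 1 ≤ Real.exp (ℓ / 10) := Real.exp_le_exp.2 (by linarith)
    have h2 : (2 : ℝ) < Real.exp 1 := by have := Real.exp_one_gt_d9; linarith
    linarith
  have hwy : w ≤ y := by rw [hwexp, hyexp]; exact Real.exp_le_exp.2 (by linarith)
  have hy2 : 2 ≤ y := by linarith
  have hyx : y ≤ (x : ℝ) + 2 := by
    have : y ≤ (x : ℝ) := by
      rw [hy]; calc (x : ℝ) ^ ((1 : ℝ) / 5) ≤ (x : ℝ) ^ (1 : ℝ) :=
            Real.rpow_le_rpow_of_exponent_le hx1.le (by norm_num)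
        _ = x := Real.rpow_one _
    linarith
  have hlogX2 : Real.log (2 * (x : ℝ) + 2) ≤ Real.log 4 + ℓ := by
    rw [hℓ, ← Real.log_mul (by norm_num) hx0.ne']; exact Real.log_le_log (by positivity) (by linarith)
  have hlogX2' : ℓ ≤ Real.log (2 * (x : ℝ) + 2) := Real.log_le_log hx0 (by linarith)
  have hlogX1' : ℓ ≤ Real.log ((x : ℝ) + 2) := Real.log_le_log hx0 (by linarith)
  have hlog6 : Real.log (2 * (x : ℝ) + 2) ≤ (6 : ℕ) * Real.log y := by
    rw [hlogy]; push_cast; linarith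
  have hw4 : w ≤ ((x : ℝ) + 2) ^ ((1 : ℝ) / 4) := by
    have h1 : w ≤ (x : ℝ) ^ ((1 : ℝ) / 4) := by
      rw [hw]; exact Real.rpow_le_rpow_of_exponent_le hx1.le (by norm_num)
    exact h1.trans (Real.rpow_le_rpow hx0.le (by linarith) (by norm_num))
  -- the sieve step at level `L = w`
  have hS := hTC x w w y hw2 le_rfl hwy hyx hlog6 hw4
  rw [show Real.log w / Real.log w = 1 from div_self (by rw [hlogw]; positivity)] at hS
  have hVsh : ∏ p ∈ (Finset.range ⌈w⌉₊).filter (fun p : ℕ => p.Prime ∧ p ≠ 2), (1 - 1 / ((p : ℝ) - 1)) ≤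
      20 / ℓ := by
    refine (Vsh_le_div_log hw2).trans (le_of_eq ?_)
    rw [hlogw]; field_simp; norm_num
  have hVsh0 : 0 ≤ ∏ p ∈ (Finset.range ⌈w⌉₊).filter (fun p : ℕ => p.Prime ∧ p ≠ 2),
      (1 - 1 / ((p : ℝ) - 1)) :=
    Finset.prod_nonneg fun p hp => by
      obtain ⟨-, hpr, hne⟩ := Finset.mem_filter.1 hp
      have h3 : (3 : ℝ) ≤ p := by exact_mod_cast (by have := hpr.two_le; omega : 3 ≤ p)
      rw [sub_nonneg, div_le_one (by linarith)]; linarith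
  -- Alladi for the cell `Ω = 5` at height `2x+2`
  have hX2 : y ≤ ((2 * x + 2 : ℕ) : ℝ) := by push_cast; linarith
  have hlogk : Real.log ((2 * x + 2 : ℕ) : ℝ) ≤ (6 : ℕ) * Real.log y := by push_cast; exact hlog6
  have hA2 := hAl ((2 * x + 2 : ℕ) : ℝ) y hy2 hX2 hlogk
  rw [Nat.floor_natCast] at hA2
  simp only [show (4 : ℕ) ≠ 0 by norm_num, if_false, sub_zero] at hA2
  obtain ⟨u, hu⟩ : ∃ u : ℝ, u = Real.log ((2 * x + 2 : ℕ) : ℝ) / Real.log y := ⟨_, rfl⟩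
  rw [← hu] at hA2
  have hlogypos : 0 < Real.log y := by rw [hlogy]; positivity
  have hu5 : 5 ≤ u := by
    rw [hu, le_div_iff₀ hlogypos, hlogy]; push_cast; linarith
  have hu5' : u ≤ 5 + 10 / ℓ := by
    rw [hu, div_le_iff₀ hlogypos, hlogy]; push_cast
    have : (5 + 10 / ℓ) * (ℓ / 5) = ℓ + 2 := by field_simp; ring
    rw [this]; linarith
  have hdist : dist u 5 < τ := by
    rw [Real.dist_eq, abs_of_nonneg (by linarith)]
    have : 10 / ℓ < τ := by
      rw [div_lt_iff₀ hℓ0]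
      have := (div_le_iff₀ hτ).1 hℓτ
      linarith
    linarith
  have hI5 : roughCellDensity (4 + 1) u ≤ e := by
    have h := hτe hdist
    rw [hρ5, Real.dist_eq, sub_zero] at h
    exact (le_abs_self _).trans h.le
  have hX4 : ((2 * x + 2 : ℕ) : ℝ) ≤ 4 * x := by push_cast; linarith
  have h := (abs_le.1 hA2).2
  have hlX0 : 0 < Real.log ((2 * x + 2 : ℕ) : ℝ) := by push_cast; linarith
  have hmain : ((2 * x + 2 : ℕ) : ℝ) * roughCellDensity (4 + 1) u / Real.log ((2 * x + 2 : ℕ) : ℝ) ≤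
      4 * e * x / ℓ := by
    have hnum : ((2 * x + 2 : ℕ) : ℝ) * roughCellDensity (4 + 1) u ≤ (4 * x) * e :=
      mul_le_mul hX4 hI5 (roughCellDensity_nonneg _ _) (by positivity)
    calc _ ≤ (4 * x) * e / Real.log ((2 * x + 2 : ℕ) : ℝ) := div_le_div_of_nonneg_right hnum hlX0.le
      _ ≤ (4 * x) * e / ℓ := div_le_div_of_nonneg_left (by positivity) hℓ0 (by push_cast; exact hlogX2')
      _ = 4 * e * x / ℓ := by ring
  have herr : CA * ((2 * x + 2 : ℕ) : ℝ) / Real.log y ^ 2 ≤ 100 * CA * x / ℓ ^ 2 := by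
    rw [hlogy]
    calc CA * ((2 * x + 2 : ℕ) : ℝ) / (ℓ / 5) ^ 2 ≤ CA * (4 * x) / (ℓ / 5) ^ 2 :=
          div_le_div_of_nonneg_right (mul_le_mul_of_nonneg_left hX4 hCA) (by positivity)
      _ = 100 * CA * x / ℓ ^ 2 := by field_simp; ring
  have hl2pos : 0 < Real.log (2 * (x : ℝ) + 2) := by linarith
  have hl1pos : 0 < Real.log ((x : ℝ) + 2) := by linarith
  have hBV : C₂ * (2 * (x : ℝ) + 2) / Real.log (2 * (x : ℝ) + 2) ^ (3 : ℝ) +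
      C₂ * ((x : ℝ) + 2) / Real.log ((x : ℝ) + 2) ^ (3 : ℝ) ≤ 8 * C₂ * x / ℓ ^ 3 := by
    have e3 : ∀ r : ℝ, r ^ (3 : ℝ) = r ^ 3 := fun r => by
      rw [← Real.rpow_natCast]; norm_num
    rw [e3, e3]
    have h1 : C₂ * (2 * (x : ℝ) + 2) / Real.log (2 * (x : ℝ) + 2) ^ 3 ≤ C₂ * (4 * x) / ℓ ^ 3 := by
      calc _ ≤ C₂ * (4 * x) / Real.log (2 * (x : ℝ) + 2) ^ 3 :=
            div_le_div_of_nonneg_right (mul_le_mul_of_nonneg_left (by linarith) hC₂) (pow_pos hl2pos 3).le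
        _ ≤ C₂ * (4 * x) / ℓ ^ 3 :=
            div_le_div_of_nonneg_left (by positivity) (by positivity) (pow_le_pow_left₀ hℓ0.le hlogX2' 3)
    have h2 : C₂ * ((x : ℝ) + 2) / Real.log ((x : ℝ) + 2) ^ 3 ≤ C₂ * (4 * x) / ℓ ^ 3 := by
      calc _ ≤ C₂ * (4 * x) / Real.log ((x : ℝ) + 2) ^ 3 :=
            div_le_div_of_nonneg_right (mul_le_mul_of_nonneg_left (by linarith) hC₂) (pow_pos hl1pos 3).le
        _ ≤ C₂ * (4 * x) / ℓ ^ 3 :=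
            div_le_div_of_nonneg_left (by positivity) (by positivity) (pow_le_pow_left₀ hℓ0.le hlogX1' 3)
    have e' : 8 * C₂ * x / ℓ ^ 3 = C₂ * (4 * x) / ℓ ^ 3 + C₂ * (4 * x) / ℓ ^ 3 := by ring
    rw [e']; exact add_le_add h1 h2
  have hK : 2 * (2000 * CA * (1 + C₁) + 8 * C₂) ≤ η * ℓ := by
    have := (div_le_iff₀ hη).1 hℓη; linarith
  exact P5_arith hS h hmain herr (Nat.cast_nonneg _) hVsh hVsh0 hBV hC₁ hCA he hη hx0 hℓ0 hK

set_option maxHeartbeats 800000 in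
/-- **The host-side error sums are `≤ δ x/log x`.** For every `δ > 0` there is `ε₀ > 0` such that
for `0 < ε ≤ ε₀` and `x ≥ x₀(ε)`, with `y = x^{1/5}`, `D = x^{1/2−2ε}`:
`Σ_{n prime, D < P⁻(n+2), Ω(n+2)=2} log n + 32 Σ_{n prime, y ≤ P⁻(n+2), Ω(n+2)=5} log n
 + 32 Σ_{n prime, y ≤ P⁻(n+2), n+2 not squarefree} log n ≤ δ x/log x` (`n ∈ (x, 2x]`). -/
theorem host_err_le : ∀ δ : ℝ, 0 < δ → ∃ ε₀ : ℝ, 0 < ε₀ ∧ ∀ ε : ℝ, 0 < ε → ε ≤ ε₀ →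
    ∃ x₀ : ℕ, ∀ x : ℕ, x₀ ≤ x →
      (∑ n ∈ (Finset.Ioc x (2 * x)).filter (fun n : ℕ => n.Prime ∧
          (x : ℝ) ^ ((1 : ℝ) / 2 - 2 * ε) < ((n + 2).minFac : ℝ) ∧ ArithmeticFunction.cardFactors (n + 2) = 2),
          Real.log (n : ℝ)) +
      32 * (∑ n ∈ (Finset.Ioc x (2 * x)).filter (fun n : ℕ => n.Prime ∧
          (x : ℝ) ^ ((1 : ℝ) / 5) ≤ ((n + 2).minFac : ℝ) ∧ ArithmeticFunction.cardFactors (n + 2) = 5),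
          Real.log (n : ℝ)) +
      32 * (∑ n ∈ (Finset.Ioc x (2 * x)).filter (fun n : ℕ => n.Prime ∧
          (x : ℝ) ^ ((1 : ℝ) / 5) ≤ ((n + 2).minFac : ℝ) ∧ ¬ Squarefree (n + 2)),
          Real.log (n : ℝ)) ≤ δ * (x : ℝ) / Real.log (x : ℝ) := by
  intro δ hδ
  obtain ⟨Cs, hCs, hstrip⟩ := strip_count_le
  refine ⟨min (1 / 25) (δ / (12 * Cs)), by positivity, fun ε hε hεle => ?_⟩
  have hε25 : ε ≤ 1 / 25 := hεle.trans (min_le_left _ _)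
  have hεC : ε ≤ δ / (12 * Cs) := hεle.trans (min_le_right _ _)
  obtain ⟨x₁, hx₁⟩ := hstrip ε hε hε25
  obtain ⟨x₂, hx₂⟩ := P5_count_le (δ / 192) (by positivity)
  obtain ⟨T, hT1, hT⟩ := exists_quadratic_le_exp (960 * 25 / δ) 0 0
  set M : ℝ := max (12 * Cs / δ) (max (5 * T) 15) with hM
  refine ⟨max (max x₁ x₂) ⌈Real.exp M⌉₊, fun x hx => ?_⟩
  have hxx₁ : x₁ ≤ x := ((le_max_left _ _).trans (le_max_left _ _)).trans hx
  have hxx₂ : x₂ ≤ x := ((le_max_right _ _).trans (le_max_left _ _)).trans hx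
  have hxE : Real.exp M ≤ (x : ℝ) := (Nat.le_ceil _).trans (by exact_mod_cast (le_max_right _ _).trans hx)
  have hx0 : (0 : ℝ) < x := (Real.exp_pos _).trans_le hxE
  set ℓ : ℝ := Real.log (x : ℝ) with hℓ
  have hℓM : M ≤ ℓ := by rw [hℓ, Real.le_log_iff_exp_le hx0]; exact hxE
  have hℓC : 12 * Cs / δ ≤ ℓ := (le_max_left _ _).trans hℓM
  have hℓT : 5 * T ≤ ℓ := ((le_max_left _ _).trans (le_max_right _ _)).trans hℓM
  have hℓ10 : 15 ≤ ℓ := ((le_max_right _ _).trans (le_max_right _ _)).trans hℓM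
  have hℓ0 : 0 < ℓ := by linarith
  have hx1 : (1 : ℝ) < x := by
    have : Real.exp 0 < Real.exp M := Real.exp_lt_exp.2 (by linarith [le_max_right (12 * Cs / δ) (max (5 * T) 15), le_max_right (5*T) (15:ℝ)])
    rw [Real.exp_zero] at this; linarith
  have hxℓ : (x : ℝ) = Real.exp ℓ := by rw [hℓ, Real.exp_log hx0]
  set y : ℝ := (x : ℝ) ^ ((1 : ℝ) / 5) with hy
  set D : ℝ := (x : ℝ) ^ ((1 : ℝ) / 2 - 2 * ε) with hD
  set w : ℝ := (x : ℝ) ^ ((1 : ℝ) / 10) with hw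
  have hy0 : 0 < y := Real.rpow_pos_of_pos hx0 _
  have hy1 : 1 ≤ y := Real.one_le_rpow hx1.le (by norm_num)
  have hlogy : Real.log y = ℓ / 5 := by rw [hy, Real.log_rpow hx0]; ring
  have hyexp : y = Real.exp (ℓ / 5) := by rw [← hlogy, Real.exp_log hy0]
  have hwx : w ≤ (x : ℝ) := by
    rw [hw]; calc (x : ℝ) ^ ((1 : ℝ) / 10) ≤ (x : ℝ) ^ (1 : ℝ) :=
          Real.rpow_le_rpow_of_exponent_le hx1.le (by norm_num)
      _ = x := Real.rpow_one _
  -- `log n ≤ 2ℓ` on the window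
  have hlog2 : Real.log 2 ≤ 1 := by have := Real.log_two_lt_d9; linarith
  have hlogn : ∀ n ∈ Finset.Ioc x (2 * x), Real.log (n : ℝ) ≤ 2 * ℓ := by
    intro n hn
    rw [Finset.mem_Ioc] at hn
    have hn0 : (0 : ℝ) < n := by exact_mod_cast (by omega : 0 < n)
    calc Real.log (n : ℝ) ≤ Real.log (2 * x) := Real.log_le_log hn0 (by exact_mod_cast hn.2)
      _ = Real.log 2 + ℓ := by rw [Real.log_mul (by norm_num) hx0.ne']
      _ ≤ 2 * ℓ := by linarith
  have hlogn0 : ∀ n ∈ Finset.Ioc x (2 * x), 0 ≤ Real.log (n : ℝ) := by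
    intro n hn
    rw [Finset.mem_Ioc] at hn
    exact Real.log_nonneg (by exact_mod_cast (by omega : 1 ≤ n))
  -- generic: a log-sum over a filter is `≤ 2ℓ · #filter`
  have hsumle : ∀ (P : ℕ → Prop) [DecidablePred P],
      ∑ n ∈ (Finset.Ioc x (2 * x)).filter P, Real.log (n : ℝ) ≤
        2 * ℓ * #((Finset.Ioc x (2 * x)).filter P) := by
    intro P _
    have h := Finset.sum_le_card_nsmul ((Finset.Ioc x (2 * x)).filter P) (fun n => Real.log (n : ℝ))
      (2 * ℓ) (fun n hn => hlogn n (Finset.mem_filter.1 hn).1)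
    rw [nsmul_eq_mul] at h
    linarith
  -- (1) the strip
  have h1 : ∑ n ∈ (Finset.Ioc x (2 * x)).filter (fun n : ℕ => n.Prime ∧
      D < ((n + 2).minFac : ℝ) ∧ ArithmeticFunction.cardFactors (n + 2) = 2), Real.log (n : ℝ) ≤
      δ / 3 * x / ℓ := by
    refine (hsumle _).trans ?_
    have hsub : (Finset.Ioc x (2 * x)).filter (fun n : ℕ => n.Prime ∧
        D < ((n + 2).minFac : ℝ) ∧ ArithmeticFunction.cardFactors (n + 2) = 2) ⊆
        (Finset.Ioc x (2 * x)).filter (fun m : ℕ =>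
          (∀ p ∈ m.primeFactors, w ≤ (p : ℝ)) ∧
          ⌈D⌉₊ ≤ (m + 2).minFac ∧ ArithmeticFunction.cardFactors (m + 2) = 1 + 1) := by
      intro n hn
      rw [Finset.mem_filter, Finset.mem_Ioc] at hn
      rw [Finset.mem_filter, Finset.mem_Ioc]
      obtain ⟨hIoc, hp, hDm, hΩ⟩ := hn
      refine ⟨hIoc, rough_of_prime hp (hwx.trans (by exact_mod_cast hIoc.1.le)),
        Nat.ceil_le.2 hDm.le, hΩ⟩
    have hc := hx₁ x hxx₁
    have hcard : (#((Finset.Ioc x (2 * x)).filter (fun n : ℕ => n.Prime ∧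
        D < ((n + 2).minFac : ℝ) ∧ ArithmeticFunction.cardFactors (n + 2) = 2)) : ℝ) ≤
        Cs * (ε * x / ℓ ^ 2 + x / ℓ ^ 3) :=
      le_trans (by exact_mod_cast Finset.card_le_card hsub) hc
    have hεℓ : 2 * Cs * ε ≤ δ / 6 := by
      have h := mul_le_mul_of_nonneg_left hεC (by positivity : (0 : ℝ) ≤ 2 * Cs)
      have e : 2 * Cs * (δ / (12 * Cs)) = δ / 6 := by field_simp; ring
      rw [e] at h; exact h
    have hCℓ : 2 * Cs / ℓ ≤ δ / 6 := by
      rw [div_le_iff₀ hℓ0]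
      have h := (div_le_iff₀ hδ).1 hℓC
      linarith
    calc 2 * ℓ * (#((Finset.Ioc x (2 * x)).filter (fun n : ℕ => n.Prime ∧
          D < ((n + 2).minFac : ℝ) ∧ ArithmeticFunction.cardFactors (n + 2) = 2)) : ℝ)
        ≤ 2 * ℓ * (Cs * (ε * x / ℓ ^ 2 + x / ℓ ^ 3)) := mul_le_mul_of_nonneg_left hcard (by positivity)
      _ = (2 * Cs * ε) * (x / ℓ) + (2 * Cs / ℓ) * (x / ℓ) := by field_simp
      _ ≤ (δ / 6) * (x / ℓ) + (δ / 6) * (x / ℓ) :=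
          add_le_add (mul_le_mul_of_nonneg_right hεℓ (by positivity))
            (mul_le_mul_of_nonneg_right hCℓ (by positivity))
      _ = δ / 3 * x / ℓ := by ring
  -- (2) the `Ω = 5` cell
  have h2 : 32 * ∑ n ∈ (Finset.Ioc x (2 * x)).filter (fun n : ℕ => n.Prime ∧
      y ≤ ((n + 2).minFac : ℝ) ∧ ArithmeticFunction.cardFactors (n + 2) = 5), Real.log (n : ℝ) ≤
      δ / 3 * x / ℓ := by
    have hsub : (Finset.Ioc x (2 * x)).filter (fun n : ℕ => n.Prime ∧
        y ≤ ((n + 2).minFac : ℝ) ∧ ArithmeticFunction.cardFactors (n + 2) = 5) ⊆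
        (Finset.Ioc x (2 * x)).filter (fun m : ℕ =>
          (∀ p ∈ m.primeFactors, w ≤ (p : ℝ)) ∧
          ⌈y⌉₊ ≤ (m + 2).minFac ∧ ArithmeticFunction.cardFactors (m + 2) = 4 + 1) := by
      intro n hn
      rw [Finset.mem_filter, Finset.mem_Ioc] at hn
      rw [Finset.mem_filter, Finset.mem_Ioc]
      obtain ⟨hIoc, hp, hym, hΩ⟩ := hn
      exact ⟨hIoc, rough_of_prime hp (hwx.trans (by exact_mod_cast hIoc.1.le)), Nat.ceil_le.2 hym, hΩ⟩
    have hc := hx₂ x hxx₂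
    have hcard : (#((Finset.Ioc x (2 * x)).filter (fun n : ℕ => n.Prime ∧
        y ≤ ((n + 2).minFac : ℝ) ∧ ArithmeticFunction.cardFactors (n + 2) = 5)) : ℝ) ≤
        δ / 192 * x / ℓ ^ 2 :=
      le_trans (by exact_mod_cast Finset.card_le_card hsub) hc
    calc 32 * ∑ n ∈ (Finset.Ioc x (2 * x)).filter (fun n : ℕ => n.Prime ∧
          y ≤ ((n + 2).minFac : ℝ) ∧ ArithmeticFunction.cardFactors (n + 2) = 5), Real.log (n : ℝ)
        ≤ 32 * (2 * ℓ * (δ / 192 * x / ℓ ^ 2)) := by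
          refine mul_le_mul_of_nonneg_left ((hsumle _).trans ?_) (by norm_num)
          exact mul_le_mul_of_nonneg_left hcard (by positivity)
      _ = δ / 3 * x / ℓ := by field_simp; ring
  -- (3) the non-squarefree shifts
  have h3 : 32 * ∑ n ∈ (Finset.Ioc x (2 * x)).filter (fun n : ℕ => n.Prime ∧
      y ≤ ((n + 2).minFac : ℝ) ∧ ¬ Squarefree (n + 2)), Real.log (n : ℝ) ≤ δ / 3 * x / ℓ := by
    have hsub : (Finset.Ioc x (2 * x)).filter (fun n : ℕ => n.Prime ∧
        y ≤ ((n + 2).minFac : ℝ) ∧ ¬ Squarefree (n + 2)) ⊆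
        (Finset.Ioc x (2 * x)).filter (fun n : ℕ => ¬ Squarefree (n + 2) ∧ y ≤ ((n + 2).minFac : ℝ)) := by
      intro n hn
      rw [Finset.mem_filter] at hn ⊢
      exact ⟨hn.1, hn.2.2.2, hn.2.2.1⟩
    have hN := card_nonSquarefree_rough_le x hy1
    have hcl := Finset.card_le_card hsub
    have hclR : (#((Finset.Ioc x (2 * x)).filter (fun n : ℕ => n.Prime ∧
        y ≤ ((n + 2).minFac : ℝ) ∧ ¬ Squarefree (n + 2))) : ℝ) ≤
        (#((Finset.Ioc x (2 * x)).filter (fun n : ℕ => ¬ Squarefree (n + 2) ∧ y ≤ ((n + 2).minFac : ℝ))) : ℝ) := by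
      exact_mod_cast hcl
    have hcard : (#((Finset.Ioc x (2 * x)).filter (fun n : ℕ => n.Prime ∧
        y ≤ ((n + 2).minFac : ℝ) ∧ ¬ Squarefree (n + 2))) : ℝ) ≤
        2 * (x : ℝ) / y + Nat.sqrt (2 * x + 2) + 1 := hclR.trans hN
    -- `2x/y + √(2x+2) + 1 ≤ 5 x^{4/5}` and `320 ℓ · x^{4/5}·... ≤ (δ/3) x/ℓ`
    have hs : ((Nat.sqrt (2 * x + 2) : ℕ) : ℝ) + 1 ≤ 3 * (x : ℝ) / y := by
      have h1 : ((Nat.sqrt (2 * x + 2) : ℕ) : ℝ) ^ 2 ≤ 2 * (x : ℝ) + 2 := by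
        exact_mod_cast Nat.sqrt_le' (2 * x + 2)
      have hy2x : y * y ≤ (x : ℝ) := by
        have h1 : ℓ / 5 + ℓ / 5 ≤ ℓ := by linarith
        calc y * y = Real.exp (ℓ / 5 + ℓ / 5) := by rw [hyexp, Real.exp_add]
          _ ≤ Real.exp ℓ := Real.exp_le_exp.2 h1
          _ = x := hxℓ.symm
      have hq : (x : ℝ) ≤ (x : ℝ) / y * ((x : ℝ) / y) := by
        rw [div_mul_div_comm, le_div_iff₀ (by positivity)]
        exact mul_le_mul_of_nonneg_left hy2x hx0.le
      have hx16 : (16 : ℝ) ≤ x := by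
        have h16 := Real.add_one_le_exp ℓ
        rw [← hxℓ] at h16; linarith
      have := sqrt_arith h1 hq hx16 (by positivity)
      rw [show 3 * (x : ℝ) / y = 3 * ((x : ℝ) / y) by ring]
      exact this
    have htot : 2 * (x : ℝ) / y + Nat.sqrt (2 * x + 2) + 1 ≤ 5 * (x : ℝ) / y := by
      calc 2 * (x : ℝ) / y + Nat.sqrt (2 * x + 2) + 1 = 2 * (x : ℝ) / y + ((Nat.sqrt (2 * x + 2) : ℝ) + 1) := by
            ring
        _ ≤ 2 * (x : ℝ) / y + 3 * (x : ℝ) / y := by gcongr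
        _ = 5 * (x : ℝ) / y := by ring
    -- growth: `960 ℓ²/δ ≤ x^{1/5} = y`
    have hgrow : 64 * ℓ * (5 * (x : ℝ) / y) ≤ δ / 3 * x / ℓ := by
      have hT' := hT (ℓ / 5) (by linarith)
      simp only [zero_mul, add_zero] at hT'
      rw [← hyexp] at hT'
      -- `960·25/δ·(ℓ/5)² = 960 ℓ²/δ ≤ y`
      have hy' : 960 * ℓ ^ 2 ≤ δ * y := by
        have h2 := mul_le_mul_of_nonneg_left hT' hδ.le
        have e : δ * (960 * 25 / δ * (ℓ / 5) ^ 2) = 960 * ℓ ^ 2 := by field_simp; ring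
        linarith [e]
      rw [show 64 * ℓ * (5 * (x : ℝ) / y) = 320 * ℓ * x / y by ring,
        div_le_div_iff₀ hy0 hℓ0]
      nlinarith [hx0]
    calc 32 * ∑ n ∈ (Finset.Ioc x (2 * x)).filter (fun n : ℕ => n.Prime ∧
          y ≤ ((n + 2).minFac : ℝ) ∧ ¬ Squarefree (n + 2)), Real.log (n : ℝ)
        ≤ 32 * (2 * ℓ * (5 * (x : ℝ) / y)) := by
          refine mul_le_mul_of_nonneg_left ((hsumle _).trans ?_) (by norm_num)
          exact mul_le_mul_of_nonneg_left (hcard.trans htot) (by positivity)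
      _ = 64 * ℓ * (5 * (x : ℝ) / y) := by ring
      _ ≤ δ / 3 * x / ℓ := hgrow
  have e : δ * (x : ℝ) / ℓ = δ / 3 * x / ℓ + δ / 3 * x / ℓ + δ / 3 * x / ℓ := by ring
  rw [e]; linarith

end Summit.Parity.GeneralizedHardyLittlewood.Theorems.ParityLeakOneFifth
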